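import Summits.CriticalPhenomena.PercolationContinuityZ3.Theorems.PercNearOneGluingNoHeavyQuantGluedWindowFarTop
import Summits.CriticalPhenomena.PercolationContinuityZ3.Theorems.PercNearOneGluingNoHeavyQuantGluedWindowDiagCore
import HarnessLib

/-!
# QUANT lane R8, T-DEC: LEMMA W's pair condition — the two-row h-mid regime with the TOP COPY UNREACHABLE for the bottom copy (`2l + r + k ≤ T`), the
# pair heavy or incompatible at the glued target (`y(h−l) ≤ T − 2l`), the middle copy reaching `h` (`T < l + r + h`), its own partner `h + r` a mid
# (`h + r ≤ j`) and HEAVY for it (`y(h−l) ≤ T − 2(l+r)`): the DIAGONAL certificate, by `diag_twoCopy` (arm-1 gen 62, architect)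

builds on p205010 (kernel theorem, internal audit signed; external expert review pending)

Support file (`--supports stmt-CriticalPhenomena-4575`), QUANT lane seat prim-quant-arm-1 (gen 62, architect); memo
`run/shared/lean/prim/quant/prim-quant-arm-1-g62/ARCH-G62.md` §1–§3.  Theorems only; standard axioms, no sorries, no definitions.

THE CELL.  Band frame and price system of `gluedPullback_windowPair_of_lemmaW` (`…QuantGluedLemmaW`); light window pair `(l, h)` below a cheap atom `c ≥ h`;
two-row regime (`2(l+r) < T ≤ 2(l+r+k)`, `l+r+k ≤ j`), `h` a mid (`T ≤ 2h`).  Here the top copy `A = l+r+k` is NOT compatible with the bottom copy `l`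
(`2l+r+k ≤ T`, i.e. `N := T−2l ≥ r+k`), the pair is heavy or incompatible at `T` (`yd ≤ N`, `d = h−l`), the middle copy reaches `h` (`N < d + r`), and `h+r`
is a mid (`h+r ≤ j`) HEAVY for the middle copy (`yd ≤ N − 2r`).  This is the part `N ≥ r+k` of arm-1 g61's open sliver (a) (memo ARCH-G61 §8) with a
heavy second copy; `…_twoRow_poolOnly` (g59) is the part `N ≥ d + r`.
THE CERTIFICATE (DIAGONAL): row `l` ↦ all of `h` at the exact heavy power `(d−N)/N` (nothing if `N ≥ d`), row `l+r` ↦ all of `h+r` at the exact heavy power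
`(d−N+2r)/(N−2r)`, both remainders ↦ the giant `h+r+k` (capacity `γt₂`, power `(1−y)/y`).  Its inequality is `diag_twoCopy` (`…QuantGluedWindowDiagCore`)
with the ratios `ν = N/d`, `ρ_1 = (N−2r)/d` and the band facts `t₀ν + t₁ρ_1 ≤ ρ₀` (from `a ≤ 1`, `m = t₁r + t₂(r+k)`, `r + k ≤ N`) and `t₂ = qg ≥ x ≥ y`.
**`gluedPullback_windowPair_twoRow_noTop_heavyG`**: the pair condition `(1−γ)Ψ(l) + γΨ(h) ≤ 0`, no `GluedLemmaW`.

HONEST STATUS.  `GluedLemmaW` (flow form), `GluedDominatedMass`, the band, `SiblingStep`, `FarTreeRow` OPEN; RATE class (log\*) / honest sentence of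
`run/shared/lean/prim/quant/README.md` unchanged.  [this work].  Nothing here is cited as a published result.  The gluing rows served
[cite: KozmaNitzan2024, Conjecture 3 (p. 15)]; product measure [cite: Grimmett1999, §1.3 p. 10].
-/

set_option maxHeartbeats 4000000

noncomputable section

namespace Summit.CriticalPhenomena.PercolationContinuityZ3.Theorems
namespace Quant
namespace LawDec

/-- **TWO-ROW REGIME, h MID, TOP COPY UNREACHABLE, SECOND COPY HEAVY**: `2l + r + k ≤ T`, `y(h−l) ≤ T−2l`, `T < l + r + h`, `h + r ≤ j`,
`y(h−l) ≤ T − 2(l+r)` ⟹ `(1−γ)Ψ(l) + γΨ(h) ≤ 0` for every price system and every cheap `c ≥ h` (the diagonal certificate). [this work] -/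
theorem gluedPullback_windowPair_twoRow_noTop_heavyG (x a q g S : ℝ) (B r k j l h c ls : ℕ) (α p : ℕ → ℝ)
    (hx0 : 0 < x) (hx1 : x < 1) (ha0 : 0 < a) (ha1 : a ≤ 1) (hq0 : 0 < q) (hq1 : q < 1) (hg0 : 0 ≤ g) (hg1 : g ≤ 1) (hr : 1 ≤ r)
    (hxqg : x ≤ q * g)
    (hlh : l < h) (hhB : h ≤ B) (hhj : h ≤ j) (hwin : j < h + r + k) (hlow : 2 * (l : ℝ) < a * S) (hcomp : a * S < (l : ℝ) + h)
    (hlight : pairGate (a * x) (a * S) l h < a * x)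
    (hL2j : l + r + k ≤ j) (hL2mid : a * (S + q * ((r : ℝ) + k * g)) ≤ 2 * ((l : ℝ) + r + k))
    (hL1low : 2 * ((l : ℝ) + r) < a * (S + q * ((r : ℝ) + k * g))) (hhmid : a * (S + q * ((r : ℝ) + k * g)) ≤ 2 * (h : ℝ))
    (hincl : 2 * (l : ℝ) + r + k ≤ a * (S + q * ((r : ℝ) + k * g)))
    (hheavyT : (a * x) * ((h : ℝ) - l) ≤ a * (S + q * ((r : ℝ) + k * g)) - 2 * (l : ℝ))
    (hcompat1 : a * (S + q * ((r : ℝ) + k * g)) < (l : ℝ) + r + h) (hjr : h + r ≤ j)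
    (hGheavy : (a * x) * ((h : ℝ) - l) ≤ a * (S + q * ((r : ℝ) + k * g)) - 2 * ((l : ℝ) + r))
    (hhc : h ≤ c) (hcB : c ≤ B) (hcj : c ≤ j)
    (hp : ∀ h, 0 ≤ p h)
    (hαp : ∀ l' h', l' ≤ j → 2 * (l' : ℝ) < a * (S + q * ((r : ℝ) + k * g)) → h' ≤ B + (r + k) →
      (j + 1 ≤ h' ∨ a * (S + q * ((r : ℝ) + k * g)) < (l' : ℝ) + h') →
      α l' ≤ usage (a * x) (a * (S + q * ((r : ℝ) + k * g))) j l' h' * p h')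
    (hcheap : -(gluedPullback (a * (S + q * ((r : ℝ) + k * g))) q g j r k α p c) * (a * x)
      < (1 - a * x) * gluedPullback (a * (S + q * ((r : ℝ) + k * g))) q g j r k α p ls) :
    (1 - pairGate (a * x) (a * S) l h) * gluedPullback (a * (S + q * ((r : ℝ) + k * g))) q g j r k α p l
      + pairGate (a * x) (a * S) l h * gluedPullback (a * (S + q * ((r : ℝ) + k * g))) q g j r k α p h ≤ 0 := by
  obtain ⟨y, hy⟩ : ∃ y : ℝ, y = a * x := ⟨_, rfl⟩
  obtain ⟨T, hT⟩ : ∃ T : ℝ, T = a * (S + q * ((r : ℝ) + k * g)) := ⟨_, rfl⟩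
  obtain ⟨T₀, hT₀⟩ : ∃ T₀ : ℝ, T₀ = a * S := ⟨_, rfl⟩
  have hy0 : 0 < y := by rw [hy]; exact mul_pos ha0 hx0
  have hyx : y ≤ x := by rw [hy]; nlinarith
  have hy1 : y < 1 := by linarith
  have h1y : 0 < 1 - y := by linarith
  obtain ⟨t1, ht1⟩ : ∃ t1 : ℝ, t1 = q * (1 - g) := ⟨_, rfl⟩
  obtain ⟨t2, ht2⟩ : ∃ t2 : ℝ, t2 = q * g := ⟨_, rfl⟩
  have ht1p : 0 ≤ t1 := by rw [ht1]; exact mul_nonneg hq0.le (by linarith)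
  have ht2p : 0 ≤ t2 := by rw [ht2]; exact mul_nonneg hq0.le hg0
  have et0 : 1 - t1 - t2 = 1 - q := by rw [ht1, ht2]; ring
  have ht0p : 0 ≤ 1 - t1 - t2 := by rw [et0]; linarith
  have hyt2 : y ≤ t2 := by rw [ht2]; linarith
  have hr1 : (1:ℝ) ≤ r := by exact_mod_cast hr
  have hr0 : (0:ℝ) ≤ r := by linarith
  have hk0 : (0:ℝ) ≤ k := Nat.cast_nonneg k
  have hlh' : (l : ℝ) < h := by exact_mod_cast hlh
  -- geometry: d = h − l, N = T − 2l, A = T − T₀ ≤ m = t1 r + t2 (r+k) ≤ t1 r + t2 N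
  obtain ⟨d, hd⟩ : ∃ d : ℝ, d = (h : ℝ) - l := ⟨_, rfl⟩
  have hd0 : 0 < d := by rw [hd]; linarith
  obtain ⟨N, hN⟩ : ∃ N : ℝ, N = T - 2 * (l : ℝ) := ⟨_, rfl⟩
  have hA : T - T₀ = a * (q * ((r : ℝ) + k * g)) := by rw [hT, hT₀]; ring
  have em : q * (1 - g) * (r : ℝ) + q * g * ((r : ℝ) + k) = q * ((r : ℝ) + k * g) := by ring
  have hAm : T - T₀ ≤ t1 * r + t2 * ((r : ℝ) + k) := by
    rw [hA, ht1, ht2]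
    have h1 : a * (q * ((r : ℝ) + k * g)) ≤ 1 * (q * ((r : ℝ) + k * g)) :=
      mul_le_mul_of_nonneg_right ha1 (by positivity)
    linarith [h1, em]
  have hNK : (r : ℝ) + k ≤ N := by rw [hN, hT]; linarith              -- row l NOT compatible with A
  have hNyd : y * d ≤ N := by rw [hN, hd, hT, hy]; exact hheavyT       -- heavy (or incompatible) at T
  have hNdr : N < d + r := by rw [hN, hd, hT]; linarith [hcompat1]      -- middle copy compatible with h
  have h2rN : 2 * (r : ℝ) < N := by rw [hN, hT]; linarith
  have hN0 : 0 < N := by linarith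
  have hAN : T - T₀ ≤ t1 * r + t2 * N := by nlinarith [hAm, mul_le_mul_of_nonneg_left hNK ht2p]
  -- the light gate of the first factor
  obtain ⟨ρ₀, hρ₀⟩ : ∃ ρ₀ : ℝ, ρ₀ = (T₀ - 2 * (l : ℝ)) / ((h : ℝ) - l) := ⟨_, rfl⟩
  have hρ₀y : ρ₀ < y := by
    have : (T₀ - 2 * (l : ℝ)) / ((h : ℝ) - l) ≤ pairGate y T₀ l h := le_max_left _ _
    rw [hρ₀]; rw [hy, hT₀] at this ⊢; linarith
  obtain ⟨γ, hγ⟩ : ∃ γ : ℝ, γ = y ^ 2 + (1 - y) * ρ₀ := ⟨_, rfl⟩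
  have hγ' : pairGate (a * x) (a * S) l h = γ := by
    rw [hγ, hρ₀, hT₀, hy]; exact pairGate_eq_light (a * x) (a * S) l h (mul_pos ha0 hx0).le (by rw [← hy, ← hT₀, ← hρ₀]; exact hρ₀y.le)
  have eρ₀ : ρ₀ = (N - (T - T₀)) / d := by rw [hρ₀, hN, hd]; congr 1; ring
  have hρ₀0 : 0 < ρ₀ := by rw [hρ₀]; exact div_pos (by rw [hT₀]; linarith) (by linarith)
  have hγ0 : 0 < γ := by rw [hγ]; positivity
  have hγy : γ < y := by rw [hγ]; nlinarith [mul_lt_mul_of_pos_left hρ₀y h1y]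
  have h1γ : 0 < 1 - γ := by linarith
  have hlowl : 2 * (l : ℝ) < T := by linarith
  have eLr : ((l + r : ℕ) : ℝ) = (l : ℝ) + r := by push_cast; ring
  have eHr : ((h + r : ℕ) : ℝ) = (h : ℝ) + r := by push_cast; ring
  have hlowlr : 2 * ((l + r : ℕ) : ℝ) < T := by rw [eLr]; linarith
  -- box coordinates ν = N/d ≥ y, ρ_1 = (N − 2r)/d ≥ y, and the band fact t0 ν + t1 ρ_1 ≤ ρ₀
  obtain ⟨nu, hnu⟩ : ∃ nu : ℝ, nu = N / d := ⟨_, rfl⟩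
  obtain ⟨r1, hr1d⟩ : ∃ r1 : ℝ, r1 = (N - 2 * (r : ℝ)) / d := ⟨_, rfl⟩
  have hnuy : y ≤ nu := by rw [hnu, le_div_iff₀ hd0]; exact hNyd
  have hn0 : 0 < nu := lt_of_lt_of_le hy0 hnuy
  have hr1y : y ≤ r1 := by
    rw [hr1d, le_div_iff₀ hd0, hN, hd, hy, hT]; linarith [hGheavy]
  have hr10 : 0 < r1 := lt_of_lt_of_le hy0 hr1y
  have hsum : (1 - t1 - t2) * nu + t1 * r1 ≤ ρ₀ := by
    rw [hnu, hr1d, eρ₀, show (1 - t1 - t2) * (N / d) + t1 * ((N - 2 * (r : ℝ)) / d) = ((1 - t1 - t2) * N + t1 * (N - 2 * r)) / d by ring]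
    refine div_le_div_of_nonneg_right ?_ hd0.le
    nlinarith [hAN, mul_nonneg ht1p hr0]
  have hs1 : (1 - t1 - t2) + t1 ≤ 1 - y := by linarith
  -- the core inequality (Cauchy–Schwarz + Lemma D)
  have core := diag_twoCopy y ρ₀ (1 - t1 - t2) t1 nu r1 hy0 hy1 hρ₀0 ht0p ht1p hs1 hnuy hr1y hsum
  rw [← hγ, show 1 - (1 - t1 - t2) - t1 = t2 by ring] at core
  -- powers: pool pu, row l into h (ph, or 0 if incompatible), row l+r into h+r (pG, heavy exact)
  obtain ⟨pu, hpu⟩ : ∃ pu : ℝ, pu = (1 - y) / y := ⟨_, rfl⟩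
  have hpu0 : 0 < pu := by rw [hpu]; exact div_pos h1y hy0
  have vP : pu * (y / (1 - y)) ≤ 1 := by rw [hpu, div_mul_div_comm, mul_comm (1 - y) y, div_self (mul_ne_zero hy0.ne' h1y.ne')]
  obtain ⟨pG, hpG⟩ : ∃ pG : ℝ, pG = (((l + r : ℕ) : ℝ) + ((h + r : ℕ) : ℝ) - T) / (T - 2 * ((l + r : ℕ) : ℝ)) := ⟨_, rfl⟩
  have hGcomp : T < ((l + r : ℕ) : ℝ) + ((h + r : ℕ) : ℝ) := by rw [eLr, eHr]; rw [hN, hd] at hNdr; linarith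
  have hGheavy' : y * ((((h + r : ℕ) : ℝ)) - ((l + r : ℕ) : ℝ)) ≤ T - 2 * ((l + r : ℕ) : ℝ) := by
    rw [eLr, eHr, show (h : ℝ) + r - ((l : ℝ) + r) = (h : ℝ) - l by ring]; rw [hy, hT]; linarith [hGheavy]
  have vG : pG * usage y T j (l + r) (h + r) ≤ 1 := by
    have e := GluedWindow.apow_heavy_valid y T 1 j (l + r) (h + r) hy0 hy1 hjr hlowlr hGcomp hGheavy'
    rw [← hpG, one_mul] at e
    exact e.le
  have epG : pG = (1 - r1) / r1 := by
    rw [hpG, hr1d, eLr, eHr, show (l : ℝ) + r + ((h : ℝ) + r) - T = d - (N - 2 * r) by rw [hd, hN]; ring,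
      show T - 2 * ((l : ℝ) + r) = N - 2 * r by rw [hN]; ring, one_sub_div hd0.ne', div_div_div_cancel_right₀ hd0.ne']
  have hpG0 : 0 ≤ pG := by
    rw [epG]; refine div_nonneg ?_ hr10.le
    rw [hr1d, sub_nonneg, div_le_one hd0]; linarith
  -- leftover of row l+r after its column h+r: t1 (1 − γ/ρ_1)
  have eL1 : (1 - γ) * t1 - γ * t1 * pG = t1 * (1 - γ / r1) := by rw [epG]; field_simp; ring
  have hL1 : 0 ≤ t1 * (1 - γ / r1) := mul_nonneg ht1p (by rw [sub_nonneg, div_le_one hr10]; linarith)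
  -- row l into h: power ph with leftover between 0 and t0 (1 − γ/ν)
  have hγn : γ / nu ≤ 1 := by rw [div_le_one hn0]; linarith
  obtain ⟨ph, hph0, vH, hcH, hL0, hL0'⟩ : ∃ ph : ℝ, 0 ≤ ph ∧ ph * usage y T j l h ≤ 1 ∧ (ph = 0 ∨ T < (l : ℝ) + h) ∧
      0 ≤ (1 - γ) * (1 - t1 - t2) - γ * (1 - t1 - t2) * ph ∧
      (1 - γ) * (1 - t1 - t2) - γ * (1 - t1 - t2) * ph ≤ (1 - t1 - t2) * (1 - γ / nu) := by
    by_cases hNd : N < d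
    · have hcompa : T < (l : ℝ) + h := by rw [hN, hd] at hNd; linarith
      have eph : ((l : ℝ) + h - T) / (T - 2 * (l : ℝ)) = (1 - nu) / nu := by
        rw [hnu, show (l : ℝ) + h - T = d - N by rw [hd, hN]; ring, ← hN, one_sub_div hd0.ne', div_div_div_cancel_right₀ hd0.ne']
      have e2 : (1 - γ) * (1 - t1 - t2) - γ * (1 - t1 - t2) * ((1 - nu) / nu) = (1 - t1 - t2) * (1 - γ / nu) := by field_simp; ring
      refine ⟨((l : ℝ) + h - T) / (T - 2 * (l : ℝ)), div_nonneg (by linarith) (by linarith), ?_, Or.inr hcompa, ?_, ?_⟩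
      · have e := GluedWindow.apow_heavy_valid y T 1 j l h hy0 hy1 hhj hlowl hcompa (by rw [← hN, ← hd]; exact hNyd)
        rw [one_mul] at e; exact e.le
      · rw [eph, e2]; exact mul_nonneg ht0p (by linarith)
      · rw [eph, e2]
    · refine ⟨0, le_rfl, by rw [zero_mul]; exact zero_le_one, Or.inl rfl, ?_, ?_⟩
      · rw [mul_zero, sub_zero]; exact mul_nonneg h1γ.le ht0p
      · have hn1 : 1 ≤ nu := by rw [hnu, le_div_iff₀ hd0]; linarith
        have : γ / nu ≤ γ := by rw [div_le_iff₀ hn0]; exact le_mul_of_one_le_right hγ0.le hn1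
        rw [mul_zero, sub_zero, mul_comm]
        exact mul_le_mul_of_nonneg_left (by linarith) ht0p
  -- shares of the pool
  have hCpos : 0 < γ * t2 * pu := by
    have : 0 < t2 := lt_of_lt_of_le hy0 hyt2
    positivity
  have coreC : (1 - t1 - t2) * (1 - γ / nu) + t1 * (1 - γ / r1) ≤ γ * t2 * pu := by
    have e : t2 * γ * ((1 - y) / y) = γ * t2 * pu := by rw [hpu]; ring
    linarith [core, e]
  obtain ⟨σ, hσ0, hσ1, hc0, hc1⟩ := diag_share ((1 - γ) * (1 - t1 - t2) - γ * (1 - t1 - t2) * ph) ((1 - γ) * t1 - γ * t1 * pG)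
    (γ * t2 * pu) hCpos hL0 (by linarith [coreC, hL1, hL0']) (by rw [eL1]; linarith [coreC, hL0'])
  -- the reduction theorem
  have h1σ : 0 ≤ 1 - σ := by linarith
  refine gluedPullback_windowPair_twoRow_mid_of_assign x a q g S B r k j l h c ls α p 0 0 ph 0 pu 0 0 pG pu
    0 1 0 σ 0 0 1 (1 - σ)
    hx0 hx1 ha0 ha1 hq0 hq1 hg0 hg1 hr hlh hhB hwin hlow hcomp hL2j hL2mid hL1low hhmid (Or.inl ⟨hjr, rfl⟩) hhc hcB hcj hp hαp hcheap
    le_rfl hph0 le_rfl hpu0.le le_rfl le_rfl hpG0 hpu0.le le_rfl zero_le_one le_rfl hσ0 le_rfl le_rfl zero_le_one h1σ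
    (by linarith) (by linarith) (by linarith) (by linarith)
    ?_ (Or.inl rfl) ?_ ?_ ?_ (Or.inl rfl) (Or.inl ?_) ?_ (Or.inl rfl) ?_ (Or.inl rfl) ?_ (Or.inr (Or.inr ?_)) (Or.inl ?_) ?_ ?_
  · rw [zero_mul]; exact zero_le_one
  · rw [← hy, ← hT]; exact vH
  · rw [← hT]; exact hcH
  · rw [zero_mul]; exact zero_le_one
  · rw [← hy]; exact vP
  · rw [zero_mul]; exact zero_le_one
  · rw [zero_mul]; exact zero_le_one
  · rw [← hy, ← hT]; exact vG
  · rw [← hT, ← eHr]; rw [eLr] at hGcomp; exact hGcomp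
  · rw [← hy]; exact vP
  · rw [hγ', ← ht1, ← ht2, ← et0]
    have e : 0 * ((1 - γ) * t2 * 0) + 1 * (γ * (1 - t1 - t2) * ph) + 0 * (γ * t1 * (1 - 0) * 0) + σ * (γ * (t2 + 0 * t1) * pu)
        = γ * (1 - t1 - t2) * ph + σ * (γ * t2 * pu) := by ring
    rw [e]; linarith [hc0]
  · rw [hγ', ← ht1, ← ht2]
    have e : 0 * ((1 - γ) * t2 * 0) + 0 * (γ * (1 - q) * 0) + 1 * (γ * t1 * (1 - 0) * pG) + (1 - σ) * (γ * (t2 + 0 * t1) * pu)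
        = γ * t1 * pG + (1 - σ) * (γ * t2 * pu) := by ring
    rw [e]; linarith [hc1]
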